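import Summits.AtomisticToContinuum.Crystallization.Theorems.ReggeStarCoercivityDefectFreeCrystallizesLayeredGluingDefs

/-!
# Part 1 of the proof of `stub_layeredGluing : LayeredGluing` (S5a, line `prestress-split-korn`, crux stmt-AtomisticToContinuum-13603); see the module docstring of the final part `ReggeStarCoercivityDefectFreeCrystallizesLayeredGluing.lean` for the overview
-/

noncomputable section

open scoped BigOperators Classical InnerProductSpace
open Filter Topology

namespace Summit.AtomisticToContinuum.Crystallization.Theorems.PrestressSplitKorn

open Summit.AtomisticToContinuum.Crystallization.Theses
open Summit.AtomisticToContinuum.Crystallization.Theses.ReggeStarCoercivity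
open Summit.AtomisticToContinuum.Crystallization.Theorems.DefectFreeCrystallizes.Negative.PredicateAPI
open Literature.MathematicalPhysics.StatisticalMechanics Literature.Geometry.DiscreteGeometry


/-! ## Algebra of the layered template -/

section Algebra

variable (a : ℝ) (s : ℤ → ℤ) (z : ℤ → ℝ)

/-- Auxiliary step `layeredPos_apply_zero` of the proof of `stub_layeredGluing` (S5a); see the final part's module docstring. -/
@[simp] theorem layeredPos_apply_zero (l : ℤ × ℤ × ℤ) :
    layeredPos a s z l 0 = a * (l.2.1 + l.2.2 / 2 + haggLabel s l.1 / 2) := by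
  simp [layeredPos, triangularVec₁, triangularVec₂, barlowOffset, layerNormal]; ring

/-- Auxiliary step `layeredPos_apply_one` of the proof of `stub_layeredGluing` (S5a); see the final part's module docstring. -/
@[simp] theorem layeredPos_apply_one (l : ℤ × ℤ × ℤ) :
    layeredPos a s z l 1 = a * √3 / 2 * (l.2.2 + haggLabel s l.1 / 3) := by
  simp [layeredPos, triangularVec₁, triangularVec₂, barlowOffset, layerNormal]; ring

/-- Auxiliary step `layeredPos_apply_two` of the proof of `stub_layeredGluing` (S5a); see the final part's module docstring. -/
@[simp] theorem layeredPos_apply_two (l : ℤ × ℤ × ℤ) : layeredPos a s z l 2 = z l.1 := by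
  simp [layeredPos, triangularVec₁, triangularVec₂, barlowOffset, layerNormal]

/-- Auxiliary step `triangularVec₁_eq_smul` of the proof of `stub_layeredGluing` (S5a); see the final part's module docstring. -/
theorem triangularVec₁_eq_smul : triangularVec₁ a = a • triangularVec₁ 1 := by
  ext i; fin_cases i <;> simp [triangularVec₁]

/-- Auxiliary step `triangularVec₂_eq_smul` of the proof of `stub_layeredGluing` (S5a); see the final part's module docstring. -/
theorem triangularVec₂_eq_smul : triangularVec₂ a = a • triangularVec₂ 1 := by
  ext i; fin_cases i <;> simp [triangularVec₂] <;> ring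

/-- Auxiliary step `barlowOffset_eq_smul` of the proof of `stub_layeredGluing` (S5a); see the final part's module docstring. -/
theorem barlowOffset_eq_smul : barlowOffset a = a • barlowOffset 1 := by
  ext i; fin_cases i <;> simp [barlowOffset] <;> ring

/-- The template point as `a • (planar part at unit spacing) + height • e₃`. -/
theorem layeredPos_eq_smul (l : ℤ × ℤ × ℤ) :
    layeredPos a s z l = a • (((l.2.1 : ℝ) • triangularVec₁ 1) + ((l.2.2 : ℝ) • triangularVec₂ 1) +
      ((haggLabel s l.1 : ℝ) • barlowOffset 1)) + z l.1 • layerNormal 1 := by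
  simp only [layeredPos]
  rw [triangularVec₁_eq_smul a, triangularVec₂_eq_smul a, barlowOffset_eq_smul a]
  module

/-- Labels of a shifted Hägg word. -/
theorem haggLabel_shift (m₀ m : ℤ) :
    haggLabel (fun k => s (k + m₀)) m = haggLabel s (m + m₀) - haggLabel s m₀ := by
  induction m using Int.induction_on with
  | zero => simp
  | succ n ih =>
    rw [haggLabel_succ, ih, show (n : ℤ) + 1 + m₀ = (n + m₀) + 1 by ring, haggLabel_succ]
    ring
  | pred n ih =>
    have h1 := haggLabel_succ (fun k => s (k + m₀)) (-(n : ℤ) - 1)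
    have h2 := haggLabel_succ s (-(n : ℤ) - 1 + m₀)
    rw [show -(n : ℤ) - 1 + 1 = -n by ring] at h1
    rw [show -(n : ℤ) - 1 + m₀ + 1 = -n + m₀ by ring] at h2
    linarith

/-- Relabelling the template at a base label `l₀`: the shifted word/heights template is the
original one translated by `-layeredPos l₀`. -/
theorem layeredPos_shift (l₀ l : ℤ × ℤ × ℤ) :
    layeredPos a (fun k => s (k + l₀.1)) (fun k => z (k + l₀.1) - z l₀.1) l =
      layeredPos a s z (l + l₀) - layeredPos a s z l₀ := by
  simp only [layeredPos, haggLabel_shift, Prod.fst_add, Prod.snd_add]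
  push_cast
  module

variable {a s z}

/-- Auxiliary step `InBox.shift` of the proof of `stub_layeredGluing` (S5a); see the final part's module docstring. -/
theorem InBox.shift (h : InBox a z) (m₀ : ℤ) : InBox a (fun k => z (k + m₀) - z m₀) := by
  refine ⟨h.1, h.2.1, fun m => ?_⟩
  have := h.2.2 (m + m₀)
  simp only [show m + 1 + m₀ = m + m₀ + 1 by ring]
  constructor <;> linarith [this.1, this.2]

/-- Auxiliary step `isHaggSeq_shift` of the proof of `stub_layeredGluing` (S5a); see the final part's module docstring. -/
theorem isHaggSeq_shift (h : IsHaggSeq s) (m₀ : ℤ) : IsHaggSeq (fun k => s (k + m₀)) :=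
  fun i => h (i + m₀)

/-- Auxiliary step `InBox.a_pos` of the proof of `stub_layeredGluing` (S5a); see the final part's module docstring. -/
theorem InBox.a_pos (h : InBox a z) : 0 < a := by linarith [h.1]

/-- Heights above layer `0`: `39/50·a·n ≤ z n - z 0 ≤ 17/20·a·n`. -/
theorem InBox.le_z_natCast (h : InBox a z) (n : ℕ) :
    39 / 50 * a * n ≤ z n - z 0 ∧ z n - z 0 ≤ 17 / 20 * a * n := by
  induction n with
  | zero => simp
  | succ n ih =>
    have := h.2.2 n
    push_cast
    constructor <;> linarith [ih.1, ih.2, this.1, this.2]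

/-- Heights below layer `0`. -/
theorem InBox.le_z_neg_natCast (h : InBox a z) (n : ℕ) :
    39 / 50 * a * n ≤ z 0 - z (-(n : ℤ)) ∧ z 0 - z (-(n : ℤ)) ≤ 17 / 20 * a * n := by
  induction n with
  | zero => simp
  | succ n ih =>
    have := h.2.2 (-((n : ℤ) + 1))
    rw [show -((n : ℤ) + 1) + 1 = -(n : ℤ) by ring] at this
    push_cast
    constructor <;> linarith [ih.1, ih.2, this.1, this.2]

/-- `|z m| ≤ |m|` and `7/10 |m| ≤ |z m|` when `z 0 = 0`. -/
theorem InBox.abs_z_le (h : InBox a z) (hz0 : z 0 = 0) (m : ℤ) :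
    |z m| ≤ |(m : ℝ)| ∧ 7 / 10 * |(m : ℝ)| ≤ |z m| := by
  have ha := h.a_pos
  rcases le_or_gt 0 m with hm | hm
  · lift m to ℕ using hm
    have h1 := h.le_z_natCast m
    rw [hz0, sub_zero] at h1
    have hz : 0 ≤ z m := le_trans (by positivity) h1.1
    rw [abs_of_nonneg hz, Int.cast_natCast, Nat.abs_cast]
    constructor <;> nlinarith [h1.1, h1.2, h.1, h.2.1]
  · obtain ⟨n, rfl⟩ : ∃ n : ℕ, m = -(n : ℤ) := ⟨(-m).toNat, by omega⟩
    have h1 := h.le_z_neg_natCast n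
    rw [hz0, zero_sub] at h1
    have hz : z (-(n : ℤ)) ≤ 0 := by linarith [h1.1, (by positivity : (0:ℝ) ≤ 39 / 50 * a * n)]
    rw [abs_of_nonpos hz, Int.cast_neg, Int.cast_natCast, abs_neg, Nat.abs_cast]
    constructor <;> nlinarith [h1.1, h1.2, h.1, h.2.1]

/-- `|haggLabel s m| ≤ |m|` for a `±1` word. -/
theorem abs_haggLabel_le (hs : IsHaggSeq s) (m : ℤ) : |haggLabel s m| ≤ |m| := by
  induction m using Int.induction_on with
  | zero => simp
  | succ n ih =>
    rw [haggLabel_succ]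
    rw [Nat.abs_cast] at ih
    rw [show |(n : ℤ) + 1| = n + 1 by rw [abs_of_nonneg (by positivity)]]
    rcases hs n with h | h <;> rw [h] <;>
      cases abs_le.1 ih <;> [apply abs_le.2; apply abs_le.2] <;> constructor <;> linarith
  | pred n ih =>
    have h1 := haggLabel_succ s (-(n : ℤ) - 1)
    rw [show -(n : ℤ) - 1 + 1 = -n by ring] at h1
    rw [abs_neg, Nat.abs_cast] at ih
    rw [show |-(n : ℤ) - 1| = n + 1 by
      rw [show -(n : ℤ) - 1 = -(n + 1) by ring, abs_neg, abs_of_nonneg (by positivity)]]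
    rw [h1] at ih
    rcases hs (-(n : ℤ) - 1) with h | h <;> rw [h] at ih <;>
      cases abs_le.1 ih <;> apply abs_le.2 <;> constructor <;> linarith

/-- **Label bound.** A template point of norm `≤ C` (box template, `z 0 = 0`) has labels of size
`≤ 4C`. -/
theorem label_bound (h : InBox a z) (hs : IsHaggSeq s) (hz0 : z 0 = 0) {C : ℝ}
    (l : ℤ × ℤ × ℤ) (hl : ‖layeredPos a s z l‖ ≤ C) :
    |(l.1 : ℝ)| ≤ 4 * C ∧ |(l.2.1 : ℝ)| ≤ 4 * C ∧ |(l.2.2 : ℝ)| ≤ 4 * C := by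
  have ha := h.1
  have ha1 := h.2.1
  have hC : 0 ≤ C := (norm_nonneg _).trans hl
  have h0 := ((show |(layeredPos a s z l) 0| ≤ ‖layeredPos a s z l‖ by simpa only [Real.norm_eq_abs] using PiLp.norm_apply_le (layeredPos a s z l) 0)).trans hl
  have h1 := ((show |(layeredPos a s z l) 1| ≤ ‖layeredPos a s z l‖ by simpa only [Real.norm_eq_abs] using PiLp.norm_apply_le (layeredPos a s z l) 1)).trans hl
  have h2 := ((show |(layeredPos a s z l) 2| ≤ ‖layeredPos a s z l‖ by simpa only [Real.norm_eq_abs] using PiLp.norm_apply_le (layeredPos a s z l) 2)).trans hl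
  rw [layeredPos_apply_zero] at h0
  rw [layeredPos_apply_one] at h1
  rw [layeredPos_apply_two] at h2
  set m := l.1
  set i := l.2.1
  set j := l.2.2
  set L : ℝ := (haggLabel s m : ℝ) with hL
  -- |m| ≤ 2C
  have hm : |(m : ℝ)| ≤ 2 * C := by
    have := (h.abs_z_le hz0 m).2
    linarith
  have hLm : |L| ≤ |(m : ℝ)| := by
    rw [hL, ← Int.cast_abs, ← Int.cast_abs]; exact_mod_cast abs_haggLabel_le hs m
  have hLC : |L| ≤ 2 * C := hLm.trans hm
  -- |j| ≤ 2C from the second coordinate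
  have h3 : (√3 : ℝ) ^ 2 = 3 := Real.sq_sqrt (by norm_num)
  have hj : |(j : ℝ)| ≤ 2 * C := by
    have hsq : (a * √3 / 2 * (j + L / 3)) ^ 2 ≤ C ^ 2 := by
      calc _ = |a * √3 / 2 * (j + L / 3)| ^ 2 := (sq_abs _).symm
        _ ≤ C ^ 2 := pow_le_pow_left₀ (abs_nonneg _) h1 2
    have hsq' : (47 / 50) ^ 2 * (3 / 4) * (j + L / 3) ^ 2 ≤ C ^ 2 := by
      have e : (a * √3 / 2 * (j + L / 3)) ^ 2 = a ^ 2 * (3 / 4) * (j + L / 3) ^ 2 := by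
        have : (a * √3 / 2 * (j + L / 3)) ^ 2 = a ^ 2 * (√3) ^ 2 / 4 * (j + L / 3) ^ 2 := by ring
        rw [this, h3]; ring
      rw [e] at hsq
      have : (47 / 50 : ℝ) ^ 2 ≤ a ^ 2 := pow_le_pow_left₀ (by norm_num) ha 2
      nlinarith [sq_nonneg (j + L / 3)]
    have hb : |(j : ℝ) + L / 3| ≤ 5 / 4 * C := by
      have : ((j : ℝ) + L / 3) ^ 2 ≤ (5 / 4 * C) ^ 2 := by nlinarith
      exact abs_le_of_sq_le_sq this (by positivity)
    have := abs_add_le ((j : ℝ) + L / 3) (-(L / 3))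
    rw [show (j : ℝ) + L / 3 + -(L / 3) = j by ring, abs_neg, abs_div,
      abs_of_pos (by norm_num : (0:ℝ) < 3)] at this
    linarith
  -- |i| ≤ 4C from the first coordinate
  have hi : |(i : ℝ)| ≤ 4 * C := by
    have hb : |(i : ℝ) + j / 2 + L / 2| ≤ 50 / 47 * C := by
      rw [abs_mul, abs_of_pos h.a_pos] at h0
      have : |(i : ℝ) + j / 2 + L / 2| * (47 / 50) ≤ C := by nlinarith [abs_nonneg ((i : ℝ) + j / 2 + L / 2)]
      linarith
    have := abs_add_le ((i : ℝ) + j / 2 + L / 2) (-(j / 2 + L / 2))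
    rw [show (i : ℝ) + j / 2 + L / 2 + -(j / 2 + L / 2) = i by ring, abs_neg] at this
    have h4 := abs_add_le ((j : ℝ) / 2) (L / 2)
    rw [abs_div, abs_div, abs_of_pos (by norm_num : (0:ℝ) < 2)] at h4
    linarith
  exact ⟨hm.trans (by linarith), hi, hj.trans (by linarith)⟩

end Algebra

/-! ## The exact local-to-global statement and the set version of `LayeredNear` -/

/-- Auxiliary step `layeredGluing_iff` of the proof of `stub_layeredGluing` (S5a); see the final part's module docstring. -/
theorem layeredGluing_iff : LayeredGluing ↔
    ∀ δ : ℝ, 0 < δ → ∀ R ε : ℝ, 0 < ε → ∃ η : ℝ, 0 < η ∧ ∃ R' : ℝ,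
    ∀ (N : ℕ) (x : Fin N → EuclideanSpace ℝ (Fin 3)), (∀ i j : Fin N, i ≠ j → δ ≤ dist (x i) (x j)) →
    ∀ i : Fin N, (∀ j : Fin N, dist (x j) (x i) ≤ R' → Good x j ∧ LayeredNear η x j) →
      ∃ (A : EuclideanSpace ℝ (Fin 3) →ₗᵢ[ℝ] (EuclideanSpace ℝ (Fin 3))) (t : EuclideanSpace ℝ (Fin 3)) (a : ℝ) (s : ℤ → ℤ) (z : ℤ → ℝ), InBox a z ∧ IsHaggSeq s ∧
        GluingWindow R ε x A t a s z := by
  simp only [LayeredGluing, GluingWindow, Set.forall_mem_range, Set.exists_range_iff]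

/-- Auxiliary step `setLayeredNear_of_layeredNear` of the proof of `stub_layeredGluing` (S5a); see the final part's module docstring. -/
theorem setLayeredNear_of_layeredNear {N : ℕ} {η : ℝ} {x : Fin N → EuclideanSpace ℝ (Fin 3)} {i j : Fin N}
    (h : LayeredNear η x j) :
    SetLayeredNear η (Set.range fun k => x k - x i) (x j - x i) := by
  obtain ⟨A, t, a, s, z, hbox, hs, h1, h2⟩ := h
  refine ⟨A, t + x i, a, s, z, hbox, hs, ?_, ?_⟩
  · rintro _ ⟨k, rfl⟩ hk
    rw [dist_sub_right] at hk
    obtain ⟨p, ⟨l, rfl⟩, hp⟩ := h1 k hk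
    exact ⟨l, by rwa [sub_add_add_cancel]⟩
  · intro l hl
    rw [sub_add_add_cancel] at hl
    obtain ⟨k, hk⟩ := h2 _ ⟨l, rfl⟩ hl
    exact ⟨_, ⟨k, rfl⟩, by rwa [sub_add_add_cancel]⟩

/-- Normal form of `SetLayeredNear` at a point of the set: relabel so that `q + t` is `η`-close to
the template ORIGIN (label `0`, `z 0 = 0`). -/
theorem SetLayeredNear.normal_form {η : ℝ} {Z : Set (EuclideanSpace ℝ (Fin 3))} {q : EuclideanSpace ℝ (Fin 3)} (h : SetLayeredNear η Z q)
    (hq : q ∈ Z) :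
    ∃ (A : EuclideanSpace ℝ (Fin 3) →ₗᵢ[ℝ] (EuclideanSpace ℝ (Fin 3))) (t : EuclideanSpace ℝ (Fin 3)) (a : ℝ) (s : ℤ → ℤ) (z : ℤ → ℝ), InBox a z ∧ IsHaggSeq s ∧
      z 0 = 0 ∧ ‖q + t‖ ≤ η ∧
      (∀ y ∈ Z, dist y q ≤ 2 → ∃ l, dist (y + t) (A (layeredPos a s z l)) ≤ η) ∧
      (∀ l, dist (A (layeredPos a s z l)) (q + t) ≤ 2 →
        ∃ y ∈ Z, dist (y + t) (A (layeredPos a s z l)) ≤ η) := by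
  obtain ⟨A, t, a, s, z, hbox, hs, h1, h2⟩ := h
  obtain ⟨l₀, hl₀⟩ := h1 q hq (by simp)
  set s' : ℤ → ℤ := fun k => s (k + l₀.1) with hs'
  set z' : ℤ → ℝ := fun k => z (k + l₀.1) - z l₀.1 with hz'
  set p₀ := A (layeredPos a s z l₀) with hp₀
  have key : ∀ l, A (layeredPos a s' z' l) = A (layeredPos a s z (l + l₀)) - p₀ := fun l => by
    rw [hs', hz', layeredPos_shift, map_sub]
  refine ⟨A, t - p₀, a, s', z', hbox.shift _, isHaggSeq_shift hs _, by simp [hz'], ?_, ?_, ?_⟩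
  · rw [← add_sub_assoc, ← dist_eq_norm]; exact hl₀
  · intro y hy hyq
    obtain ⟨l, hl⟩ := h1 y hy hyq
    refine ⟨l - l₀, ?_⟩
    rwa [key, sub_add_cancel, ← add_sub_assoc, dist_sub_right]
  · intro l hl
    rw [key] at hl ⊢
    rw [← add_sub_assoc, dist_sub_right] at hl
    obtain ⟨y, hy, hyl⟩ := h2 (l + l₀) hl
    exact ⟨y, hy, by rwa [← add_sub_assoc, dist_sub_right]⟩

/-! ## Passage to the limit: tools -/

/-- Continuity of the template point in its parameters at a fixed label. -/
theorem haggLabel_congr {s s' : ℤ → ℤ} {m : ℤ} (h : ∀ i : ℤ, |i| ≤ |m| → s i = s' i) :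
    haggLabel s m = haggLabel s' m := by
  unfold haggLabel haggWindow
  split_ifs with hm
  · refine Finset.sum_congr rfl fun i hi => h _ ?_
    rw [Finset.mem_range] at hi
    rw [zero_add, abs_of_nonneg hm, Nat.abs_cast]
    omega
  · congr 1
    refine Finset.sum_congr rfl fun i hi => h _ ?_
    rw [Finset.mem_range] at hi
    rw [abs_of_neg (not_le.1 hm), abs_le]
    omega

/-- Auxiliary step `tendsto_layeredPos` of the proof of `stub_layeredGluing` (S5a); see the final part's module docstring. -/
theorem tendsto_layeredPos {a : ℕ → ℝ} {s : ℕ → ℤ → ℤ} {z : ℕ → ℤ → ℝ} {a' : ℝ} {s' : ℤ → ℤ}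
    {z' : ℤ → ℝ} (ha : Tendsto a atTop (𝓝 a')) (hs : ∀ m, ∀ᶠ k in atTop, s k m = s' m)
    (hz : ∀ m, Tendsto (fun k => z k m) atTop (𝓝 (z' m))) (l : ℤ × ℤ × ℤ) :
    Tendsto (fun k => layeredPos (a k) (s k) (z k) l) atTop (𝓝 (layeredPos a' s' z' l)) := by
  have hL : ∀ᶠ k in atTop, haggLabel (s k) l.1 = haggLabel s' l.1 := by
    have : ∀ᶠ k in atTop, ∀ i ∈ Finset.Icc (-|l.1|) |l.1|, s k i = s' i :=
      (Filter.eventually_all_finset _).2 fun i _ => hs i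
    refine this.mono fun k hk => haggLabel_congr fun i hi => hk i ?_
    rw [Finset.mem_Icc]; exact abs_le.1 hi
  have heq : (fun k => a k • (((l.2.1 : ℝ) • triangularVec₁ 1) + ((l.2.2 : ℝ) • triangularVec₂ 1) +
        ((haggLabel s' l.1 : ℝ) • barlowOffset 1)) + z k l.1 • layerNormal 1) =ᶠ[atTop]
      fun k => layeredPos (a k) (s k) (z k) l :=
    hL.mono fun k hk => by dsimp only; rw [layeredPos_eq_smul, hk]
  refine Tendsto.congr' heq ?_
  rw [layeredPos_eq_smul]
  exact (ha.smul tendsto_const_nhds).add ((hz l.1).smul tendsto_const_nhds)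

/-- Auxiliary step `tendsto_isometry_apply` of the proof of `stub_layeredGluing` (S5a); see the final part's module docstring. -/
theorem tendsto_isometry_apply {A : ℕ → EuclideanSpace ℝ (Fin 3) →ₗᵢ[ℝ] (EuclideanSpace ℝ (Fin 3))} {A' : EuclideanSpace ℝ (Fin 3) →ₗᵢ[ℝ] (EuclideanSpace ℝ (Fin 3))}
    (hA : ∀ v, Tendsto (fun k => A k v) atTop (𝓝 (A' v))) {v : ℕ → EuclideanSpace ℝ (Fin 3)} {v' : EuclideanSpace ℝ (Fin 3)}
    (hv : Tendsto v atTop (𝓝 v')) : Tendsto (fun k => A k (v k)) atTop (𝓝 (A' v')) := by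
  rw [tendsto_iff_dist_tendsto_zero]
  have h1 : Tendsto (fun k => dist (v k) v' + dist (A k v') (A' v')) atTop (𝓝 0) := by
    have := (tendsto_iff_dist_tendsto_zero.1 hv).add (tendsto_iff_dist_tendsto_zero.1 (hA v'))
    rwa [add_zero] at this
  refine squeeze_zero (fun k => dist_nonneg) (fun k => ?_) h1
  calc dist (A k (v k)) (A' v') ≤ dist (A k (v k)) (A k v') + dist (A k v') (A' v') :=
        dist_triangle _ _ _
    _ = dist (v k) v' + dist (A k v') (A' v') := by rw [LinearIsometry.dist_map]

/-- Pigeonhole for `∃ᶠ` over a finite set of alternatives. -/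
theorem exists_frequently_of_frequently_exists {ι : Type*} (I : Finset ι) {p : ι → ℕ → Prop}
    (h : ∃ᶠ k in atTop, ∃ i ∈ I, p i k) : ∃ i ∈ I, ∃ᶠ k in atTop, p i k := by
  by_contra hc
  push Not at hc
  have hall : ∀ᶠ k in atTop, ∀ i ∈ I, ¬ p i k := (Filter.eventually_all_finset I).2 hc
  obtain ⟨k, ⟨i, hi, hpk⟩, hk⟩ := (h.and_eventually hall).exists
  exact hk i hi hpk

/-- A point approached arbitrarily well by a locally finite set belongs to it. -/
theorem mem_of_forall_exists_dist_le {Y : Set (EuclideanSpace ℝ (Fin 3))} {w : EuclideanSpace ℝ (Fin 3)} (hfin : (Y ∩ Metric.closedBall w 1).Finite)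
    (h : ∀ γ : ℝ, 0 < γ → ∃ y ∈ Y, dist y w ≤ γ) : w ∈ Y := by
  have hcl : w ∈ closure (Y ∩ Metric.closedBall w 1) := by
    rw [Metric.mem_closure_iff]
    intro ε hε
    obtain ⟨y, hy, hyw⟩ := h (min (ε / 2) 1) (by positivity)
    refine ⟨y, ⟨hy, Metric.mem_closedBall.2 (hyw.trans (min_le_right _ _))⟩, ?_⟩
    rw [dist_comm]
    exact lt_of_le_of_lt (hyw.trans (min_le_left _ _)) (by linarith)
  rw [hfin.isClosed.closure_eq] at hcl
  exact hcl.1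

/-- `frequently f ≤ g`, `f → D`, `g → 0` give `D ≤ 0`. -/
theorem le_zero_of_frequently_le {f g : ℕ → ℝ} {D : ℝ} (hf : Tendsto f atTop (𝓝 D))
    (hg : Tendsto g atTop (𝓝 0)) (h : ∃ᶠ k in atTop, f k ≤ g k) : D ≤ 0 := by
  by_contra hD
  push Not at hD
  have h1 : ∀ᶠ k in atTop, D / 2 < f k := hf.eventually (lt_mem_nhds (by linarith))
  have h2 : ∀ᶠ k in atTop, g k < D / 2 := hg.eventually (gt_mem_nhds (by linarith))
  obtain ⟨k, hk, hk1, hk2⟩ := (h.and_eventually (h1.and h2)).exists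
  linarith

/-- Every point of the local limit is the limit of a sequence of particles. -/
theorem exists_seq_tendsto {Z : ℕ → Set (EuclideanSpace ℝ (Fin 3))} {Y : Set (EuclideanSpace ℝ (Fin 3))}
    (hmatch : ∀ ρ γ : ℝ, 0 < γ → ∀ᶠ k in atTop, BallMatch γ ρ 0 (Z k) Y) {y : EuclideanSpace ℝ (Fin 3)} (hy : y ∈ Y) :
    ∃ u : ℕ → EuclideanSpace ℝ (Fin 3), (∀ᶠ k in atTop, u k ∈ Z k) ∧ Tendsto u atTop (𝓝 y) := by
  have hex : ∀ k : ℕ, ∃ q : EuclideanSpace ℝ (Fin 3), (Z k).Nonempty →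
      q ∈ Z k ∧ dist y q < Metric.infDist y (Z k) + 1 / ((k : ℝ) + 1) := by
    intro k
    by_cases hne : (Z k).Nonempty
    · obtain ⟨q, hq, hd⟩ := (Metric.infDist_lt_iff hne).1
        (lt_add_of_pos_right (Metric.infDist y (Z k)) (by positivity : (0:ℝ) < 1 / ((k : ℝ) + 1)))
      exact ⟨q, fun _ => ⟨hq, hd⟩⟩
    · exact ⟨0, fun h => absurd h hne⟩
  choose u hu using hex
  have hclose : ∀ γ : ℝ, 0 < γ → ∀ᶠ k in atTop, (Z k).Nonempty ∧ Metric.infDist y (Z k) ≤ γ := by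
    intro γ hγ
    filter_upwards [hmatch ‖y‖ γ hγ] with k hk
    obtain ⟨q, hq, hqy⟩ := hk.1 y hy (by simp)
    exact ⟨⟨q, hq⟩, (Metric.infDist_le_dist_of_mem hq).trans (by rwa [dist_comm])⟩
  refine ⟨u, ?_, ?_⟩
  · filter_upwards [hclose 1 one_pos] with k hk using (hu k hk.1).1
  · rw [Metric.tendsto_nhds]
    intro ε hε
    have h1 : ∀ᶠ k : ℕ in atTop, 1 / ((k : ℝ) + 1) < ε / 2 :=
      (tendsto_one_div_add_atTop_nhds_zero_nat (𝕜 := ℝ)).eventually (gt_mem_nhds (half_pos hε))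
    filter_upwards [hclose (ε / 2) (half_pos hε), h1] with k hk hk1
    have := (hu k hk.1).2
    rw [dist_comm]
    linarith [hk.2]

/-- Landing anchor of this file (registered stub of crux stmt-AtomisticToContinuum-13603; re-exports a result above). -/
theorem layeredGluing_part01_anchor :
    ∀ (s : ℤ → ℤ) (m₀ m : ℤ), haggLabel (fun k => s (k + m₀)) m = haggLabel s (m + m₀) - haggLabel s m₀ :=
  fun s m₀ m => haggLabel_shift s m₀ m

end Summit.AtomisticToContinuum.Crystallization.Theorems.PrestressSplitKorn
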